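import Mathlib
import HarnessLib

/-!
# Complex-coefficient degree-2 Routh–Hurwitz via the root identity, and the dVOC modal-lag threshold
# `η·λ < (1 + ρ²)/ρ³` (card idea-2 (cycle 4) / modal-lag-line-dynamics-threshold, support P1)

Venture GRIDFUSION, G2-SCALE cell; lead §43 D60 «T10 = P1 (complex-coefficient degree-2 Routh–Hurwitz) → writer lit-4»;
card HOME/IDEAS-G2.md l.490 ff (REV 2 6f4251cf62cebae6; crit-1 GRADE PASS · NEW-COMBINATION l.10531/32), whose typed
scratch `HOME/idea-2/toy-g4/ModalLagRH.lean` (sha16 df9f906322000ace, rc 0) this module files — the GENERIC lemmas and the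
generic modal threshold verbatim in content; the two instance inequalities of the scratch (`caracas_edge34_exceeds`,
`d1_exceeds`) are NOT filed (D60: no CARACAS-numbered claim commissioned).  Typed by gridfusion-lit-4 (g14), 2026-08-28.
0 kit, 0 facts, Mathlib only.

For the monic complex quadratic `s² + (a + ib)s + (p + iq)` with `a > 0`, every root `s = x + iy` satisfies the
ROOT IDENTITY `a²p + abq − q² = −x(x + a)((2y + b)² + a²)`, whence: `D := a²p + abq − q² > 0` ⇒ every root has
`Re s < 0`; `D < 0` ⇒ some root has `Re s > 0` (roots exist by `IsAlgClosed.exists_pow_nat_eq`, Vieta gives the second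
root); `D = 0` ⇒ a root on the imaginary axis.  Applied to the per-Laplacian-mode polynomial of the dVOC + RL-line model
(GrossEtAl2019 (15) under its Assumption 1, per-unit time, `ρ = tan κ = x/r`): `s² + (1/ρ + i)s + ηλ(1/ρ + i)` is Hurwitz
if `0 < ηλ < (1 + ρ²)/ρ³` and has a root in `Re > 0` if `ηλ > (1 + ρ²)/ρ³`.  MODELLED column only (a statement about a
scalar polynomial attached to model (15)); nothing here certifies a converter, a feeder or a grid.

## Contents
* `det_eq_of_root`, `re_eq`, `im_eq`, `det_eq_of_root'` (the root identity); **`root_re_neg`** (stable side),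
  `exists_root`, `second_root` (Vieta), **`exists_root_re_pos`** (unstable side), `exists_root_re_zero` (boundary);
* `modal_det`, **`modal_root_re_neg`**, **`modal_exists_root_re_pos`** (the threshold `(1 + ρ²)/ρ³`).
-/

namespace Summit.Ventures.GridStability.Lyapunov.ModalLag

open Complex

/-- Root identity: real/imaginary parts of `s² + (a+ib)s + (p+iq) = 0` at `s = x + iy` force
`a²p + abq − q² = −x(x+a)((2y+b)² + a²)`. -/
theorem det_eq_of_root (a b p q x y : ℝ)
    (hre : x ^ 2 - y ^ 2 + a * x - b * y + p = 0) (him : 2 * x * y + a * y + b * x + q = 0) :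
    a ^ 2 * p + a * b * q - q ^ 2 = -(x * (x + a) * ((2 * y + b) ^ 2 + a ^ 2)) := by
  have hp : p = -(x ^ 2 - y ^ 2 + a * x - b * y) := by linarith
  have hq : q = -(2 * x * y + a * y + b * x) := by linarith
  subst hp hq
  ring

/-- Real part of the quadratic at `s`. -/
theorem re_eq (a b p q : ℝ) (s : ℂ) :
    (s ^ 2 + (a + b * I) * s + (p + q * I)).re = s.re ^ 2 - s.im ^ 2 + a * s.re - b * s.im + p := by
  simp [sq, Complex.mul_re, Complex.add_re]; ring

/-- Imaginary part of the quadratic at `s`. -/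
theorem im_eq (a b p q : ℝ) (s : ℂ) :
    (s ^ 2 + (a + b * I) * s + (p + q * I)).im = 2 * s.re * s.im + a * s.im + b * s.re + q := by
  simp [sq, Complex.mul_im, Complex.add_im]; ring

/-- Root identity, complex form. -/
theorem det_eq_of_root' (a b p q : ℝ) (s : ℂ) (hs : s ^ 2 + (a + b * I) * s + (p + q * I) = 0) :
    a ^ 2 * p + a * b * q - q ^ 2 = -(s.re * (s.re + a) * ((2 * s.im + b) ^ 2 + a ^ 2)) := by
  have hre : s.re ^ 2 - s.im ^ 2 + a * s.re - b * s.im + p = 0 := by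
    rw [← re_eq a b p q s, hs]; simp
  have him : 2 * s.re * s.im + a * s.im + b * s.re + q = 0 := by
    rw [← im_eq a b p q s, hs]; simp
  exact det_eq_of_root a b p q s.re s.im hre him

/-- Complex Routh–Hurwitz, degree 2, stable direction: `a > 0` and `a²p + abq − q² > 0` force every root into `Re < 0`. -/
theorem root_re_neg (a b p q : ℝ) (ha : 0 < a) (hD : 0 < a ^ 2 * p + a * b * q - q ^ 2)
    (s : ℂ) (hs : s ^ 2 + (a + b * I) * s + (p + q * I) = 0) : s.re < 0 := by
  have hid := det_eq_of_root' a b p q s hs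
  by_contra h
  push Not at h
  have h1 : 0 ≤ s.re * (s.re + a) := mul_nonneg h (by linarith)
  have h2 : 0 ≤ s.re * (s.re + a) * ((2 * s.im + b) ^ 2 + a ^ 2) := mul_nonneg h1 (by positivity)
  linarith

/-- Existence of a root of the monic complex quadratic (square root of the discriminant). -/
theorem exists_root (B C : ℂ) : ∃ s : ℂ, s ^ 2 + B * s + C = 0 := by
  obtain ⟨w, hw⟩ := IsAlgClosed.exists_pow_nat_eq (B ^ 2 - 4 * C) (by norm_num : 0 < 2)
  refine ⟨(-B + w) / 2, ?_⟩
  have : w ^ 2 = B ^ 2 - 4 * C := hw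
  field_simp
  linear_combination this

/-- Vieta: if `s₁` is a root then so is `−B − s₁`. -/
theorem second_root (B C s : ℂ) (hs : s ^ 2 + B * s + C = 0) :
    (-B - s) ^ 2 + B * (-B - s) + C = 0 := by
  linear_combination hs

/-- Complex Routh–Hurwitz, degree 2, unstable direction: `a > 0` and `a²p + abq − q² < 0` give a root with `Re > 0`. -/
theorem exists_root_re_pos (a b p q : ℝ) (ha : 0 < a) (hD : a ^ 2 * p + a * b * q - q ^ 2 < 0) :
    ∃ s : ℂ, s ^ 2 + (a + b * I) * s + (p + q * I) = 0 ∧ 0 < s.re := by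
  obtain ⟨s, hs⟩ := exists_root (a + b * I) (p + q * I)
  by_cases h : 0 < s.re
  · exact ⟨s, hs, h⟩
  · push Not at h
    refine ⟨-(a + b * I) - s, second_root _ _ s hs, ?_⟩
    have hid := det_eq_of_root' a b p q s hs
    -- from D < 0: s.re * (s.re + a) > 0, and s.re ≤ 0 ⇒ s.re + a < 0
    have hpos : 0 < (2 * s.im + b) ^ 2 + a ^ 2 := by positivity
    have hprod : 0 < s.re * (s.re + a) := by
      by_contra hc
      push Not at hc
      have : s.re * (s.re + a) * ((2 * s.im + b) ^ 2 + a ^ 2) ≤ 0 :=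
        mul_nonpos_of_nonpos_of_nonneg hc hpos.le
      linarith
    have hlt : s.re + a < 0 := by
      by_contra hc
      push Not at hc
      have : s.re * (s.re + a) ≤ 0 := mul_nonpos_of_nonpos_of_nonneg h hc
      linarith
    have : (-(a + b * I) - s).re = -a - s.re := by simp
    rw [this]
    linarith

/-- On the boundary `D = 0` there is a root on the imaginary axis (`Re s = 0`). -/
theorem exists_root_re_zero (a b p q : ℝ) (ha : 0 < a) (hD : a ^ 2 * p + a * b * q - q ^ 2 = 0) :
    ∃ s : ℂ, s ^ 2 + (a + b * I) * s + (p + q * I) = 0 ∧ s.re = 0 := by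
  obtain ⟨s, hs⟩ := exists_root (a + b * I) (p + q * I)
  have hid := det_eq_of_root' a b p q s hs
  have hpos : 0 < (2 * s.im + b) ^ 2 + a ^ 2 := by positivity
  have hprod : s.re * (s.re + a) = 0 := by
    have h0 : s.re * (s.re + a) * ((2 * s.im + b) ^ 2 + a ^ 2) = 0 := by linarith
    rcases mul_eq_zero.mp h0 with h | h
    · exact h
    · linarith
  rcases mul_eq_zero.mp hprod with h | h
  · exact ⟨s, hs, h⟩
  · refine ⟨-(a + b * I) - s, second_root _ _ s hs, ?_⟩
    have : (-(a + b * I) - s).re = -a - s.re := by simp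
    rw [this]; linarith

/-! ## The dVOC modal-lag threshold (GrossEtAl2019 (15), Assumption 1, pu time, `ρ = tan κ = x/r`) -/

/-- The determinant of the modal polynomial `s² + (1/ρ + i)s + ηλ(1/ρ + i)` factors as `ηλ·((1+ρ²)/ρ³ − ηλ)`. -/
theorem modal_det (ρ c : ℝ) (hρ : ρ ≠ 0) :
    (1 / ρ) ^ 2 * (c / ρ) + (1 / ρ) * 1 * c - c ^ 2 = c * ((1 + ρ ^ 2) / ρ ^ 3 - c) := by
  field_simp

/-- STABLE SIDE: if `0 < ηλ < (1+ρ²)/ρ³` every root of the modal polynomial has negative real part. -/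
theorem modal_root_re_neg (ρ η μ : ℝ) (hρ : 0 < ρ) (hpos : 0 < η * μ) (hlt : η * μ < (1 + ρ ^ 2) / ρ ^ 3)
    (s : ℂ) (hs : s ^ 2 + ((1 / ρ : ℝ) + (1 : ℝ) * I) * s + ((η * μ / ρ : ℝ) + (η * μ : ℝ) * I) = 0) :
    s.re < 0 := by
  have hD : 0 < (1 / ρ) ^ 2 * (η * μ / ρ) + (1 / ρ) * 1 * (η * μ) - (η * μ) ^ 2 := by
    rw [modal_det ρ (η * μ) hρ.ne']
    exact mul_pos hpos (by linarith)
  exact root_re_neg (1 / ρ) 1 (η * μ / ρ) (η * μ) (by positivity) hD s hs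

/-- UNSTABLE SIDE: if `ηλ > (1+ρ²)/ρ³` (and `ρ > 0`) the modal polynomial has a root with positive real part. -/
theorem modal_exists_root_re_pos (ρ η μ : ℝ) (hρ : 0 < ρ) (hgt : (1 + ρ ^ 2) / ρ ^ 3 < η * μ) :
    ∃ s : ℂ, s ^ 2 + ((1 / ρ : ℝ) + (1 : ℝ) * I) * s + ((η * μ / ρ : ℝ) + (η * μ : ℝ) * I) = 0 ∧ 0 < s.re := by
  have hpos : 0 < η * μ := lt_trans (by positivity) hgt
  have hD : (1 / ρ) ^ 2 * (η * μ / ρ) + (1 / ρ) * 1 * (η * μ) - (η * μ) ^ 2 < 0 := by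
    rw [modal_det ρ (η * μ) hρ.ne']
    exact mul_neg_of_pos_of_neg hpos (by linarith)
  exact exists_root_re_pos (1 / ρ) 1 (η * μ / ρ) (η * μ) (by positivity) hD

end Summit.Ventures.GridStability.Lyapunov.ModalLag
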